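import Summits.Ventures.PercRepro.ProfileRowAllLoop

/-!
# PercRepro — THE POINTED CONJECTURE (Ĉ): ITS AUTOMATIC REGIME, AND ITS AVERAGE OVER THE POINT IS A THEOREM
(p10, gen 13; `proofs/P10-AVFULL.md` §21)

For a finite matroid `M` on `N = #E` elements, `P_k := #biIndepSets M k` (ProfileBiIndepDensity) and a point
`p ∈ E`, let `c^p_k` (`extCount M k p`) be the number of bi-independent `k`-sets `X ∌ p` whose extension `X ∪ p`
is again bi-independent — equivalently `p ∉ cl X` (`insert_mem_biIndepSets_iff`), equivalently `P_k(M / p)`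
(`extCount_eq_card_biIndepSets_contract`).  THE POINTED CONJECTURE (Ĉ) of §20(4) (S5 v66 §2.2(xxi)(4); NOT
asserted) reads, for `2k + 2 ≤ N`,

  `(N − k − 1) · P_k ≤ k · P_{k+1} + (N − 2k − 1) · c^p_k`.                                          (Ĉ)

Theorem A (the named fact `BiIndepDensityLogConcave`, Brändén–Huh) is `(N − k) · P_k ≤ (k + 1) · P_{k+1}`; the
free coextension of §20 makes (Ĉ) the row `RowAll` (ProfileRowAll).  THIS FILE:

* `PointedRow` — (Ĉ) for every finite matroid, point and level, as a `Prop` (NOT asserted);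
* `pointedRow_of_le_extCount` — THE AUTOMATIC REGIME: whenever `P_k ≤ (k + 1) · c^p_k` (the point `p` is captured
  by at most a `k/(k+1)` fraction of the bi-independent `k`-sets), (Ĉ) at `(M, p, k)` follows from Theorem A alone;
  the content of (Ĉ) is the over-captured regime `c^p_k < P_k/(k+1)` (parallel pairs, the tight instance of §20);
* `pointed_average_of_fact` — THE AVERAGE OF (Ĉ) OVER THE POINT IS A THEOREM (modulo Theorem A):
  `N·(N − k − 1)·P_k ≤ N·k·P_{k+1} + (N − 2k − 1)·Σ_{p ∈ E} c^p_k`, with slack `k·(N−2k−1)·(N−2k−2)·P_k/(k+1)`.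
  The two ingredients are elementary: `Σ_p c^p_k` counts the pairs `X ⊂ X'` of bi-independent sets at levels
  `k`, `k+1` (`sum_extCount_eq`, a bipartite double count), and a bi-independent `k`-set captures at most `k`
  elements of its complement (`card_captured_le`: `Z ∩ cl X` is an independent subset of a flat of rank `k`),
  so each `X` has at least `N − 2k` extensions (`card_ext_ge`) and `Σ_p c^p_k ≥ (N − 2k)·P_k` (`sum_extCount_ge`).

Everything is unconditional except the two theorems that invoke the named fact (`pointedRow_of_le_extCount`,
`pointed_average_of_fact`); nothing here asserts (Ĉ).
-/

open scoped Matroid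

namespace PercRepro.Cogirth

open Finset ThmH Skew

variable {α : Type} [DecidableEq α] {M : Matroid α} [M.Finite]

/-- `c^p_k`: the bi-independent `k`-sets avoiding `p` whose extension by `p` is again bi-independent. -/
noncomputable def extCount (M : Matroid α) [M.Finite] (k : ℕ) (p : α) : ℕ :=
  ((biIndepSets M k).filter (fun X => p ∉ X ∧ insert p X ∈ biIndepSets M (k + 1))).card

/-- **THE POINTED CONJECTURE (Ĉ) (NOT asserted)**: for every finite matroid on `α`, every point `p` of it and every
level `k` with `2k + 2 ≤ #E`, `(N − k − 1) · P_k ≤ k · P_{k+1} + (N − 2k − 1) · c^p_k`. -/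
def PointedRow (α : Type) [DecidableEq α] : Prop :=
  ∀ (M : Matroid α) [M.Finite] (p : α) (k : ℕ), p ∈ gr M → 2 * k + 2 ≤ (gr M).card →
    ((gr M).card - k - 1) * (biIndepSets M k).card ≤
      k * (biIndepSets M (k + 1)).card + ((gr M).card - 2 * k - 1) * extCount M k p

omit [DecidableEq α] in
/-- A finset of full rank is independent. -/
theorem indep_of_rk_eq_card' {X : Finset α} (h : rk M X = X.card) : M.Indep (X : Set α) := by
  rw [Matroid.indep_iff_eRk_eq_encard_of_finite (Finset.finite_toSet X), ← coe_rk, h,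
    Set.encard_coe_eq_coe_finsetCard]

omit [DecidableEq α] in
/-- An independent finset has full rank. -/
theorem rk_eq_card_of_indep' {X : Finset α} (h : M.Indep (X : Set α)) : rk M X = X.card := by
  have h1 := h.eRk_eq_encard
  rw [← coe_rk, Set.encard_coe_eq_coe_finsetCard] at h1
  exact_mod_cast h1

omit [DecidableEq α] in
/-- A subset of a full-rank finset has full rank. -/
theorem rk_eq_card_of_subset_of_rk_eq_card {X Y : Finset α} (hXY : X ⊆ Y) (hY : rk M Y = Y.card) :
    rk M X = X.card :=
  rk_eq_card_of_indep' ((indep_of_rk_eq_card' hY).subset (by exact_mod_cast hXY))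

/-- For a bi-independent `k`-set `X` and a point `p ∉ X`: `X ∪ p` is bi-independent iff `p ∉ cl X`. -/
theorem insert_mem_biIndepSets_iff {k : ℕ} {X : Finset α} (hX : X ∈ biIndepSets M k) {p : α}
    (hp : p ∈ gr M) (hpX : p ∉ X) :
    insert p X ∈ biIndepSets M (k + 1) ↔ p ∉ clF M X := by
  rw [mem_biIndepSets] at hX
  obtain ⟨hXg, hXk, hXr, hXc⟩ := hX
  have hins := rk_insert_eq hp hXg
  rw [mem_biIndepSets]
  constructor
  · rintro ⟨-, -, hr, -⟩ hcl
    rw [if_pos hcl, hXr] at hins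
    rw [card_insert_of_notMem hpX] at hr
    omega
  · intro hcl
    rw [if_neg hcl] at hins
    refine ⟨insert_subset hp hXg, ?_, ?_, ?_⟩
    · rw [card_insert_of_notMem hpX, hXk]
    · rw [hins, hXr, card_insert_of_notMem hpX]
    · exact rk_eq_card_of_subset_of_rk_eq_card
        (sdiff_subset_sdiff (subset_refl _) (subset_insert _ _)) hXc

/-- `c^p_k = P_k(M / p)` for a non-loop `p`: the (Ĉ)-compensation is the bi-independent count of the contraction
`M / p` (on `E ∖ p`): `X ∈ BI_k(M / p)` iff `X ∪ p` and `E ∖ X` are independent in `M`. -/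
theorem extCount_eq_card_biIndepSets_contract {p : α} (hp : M.Indep {p}) (k : ℕ) :
    extCount M k p = (biIndepSets (M ／ ({p} : Set α)) k).card := by
  have hpg : p ∈ gr M := mem_gr_of_indep hp
  unfold extCount
  apply card_bij (fun X _ => X)
  · intro X hX
    rw [mem_filter, mem_biIndepSets, mem_biIndepSets] at hX
    obtain ⟨⟨hXg, hXk, -, hXc⟩, hpX, ⟨-, -, hIr, -⟩⟩ := hX
    have hpZ : p ∈ gr M \ X := mem_sdiff.2 ⟨hpg, hpX⟩
    have hXg' : X ⊆ (gr M).erase p := by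
      intro x hx
      rw [mem_erase]
      exact ⟨fun h => hpX (h ▸ hx), hXg hx⟩
    rw [mem_biIndepSets, gr_contract']
    refine ⟨hXg', hXk, ?_, ?_⟩
    · have h := rk_contract_add_one hp hXg'
      rw [hIr, card_insert_of_notMem hpX] at h
      omega
    · have h := rk_contract_add_one hp (sdiff_subset : (gr M).erase p \ X ⊆ (gr M).erase p)
      rw [erase_sdiff, insert_erase hpZ, hXc, ← card_erase_add_one hpZ] at h
      rw [erase_sdiff]
      omega
  · intro X _ Y _ h
    exact h
  · intro Y hY
    refine ⟨Y, ?_, rfl⟩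
    rw [mem_biIndepSets, gr_contract'] at hY
    obtain ⟨hYg, hYk, hYr, hYc⟩ := hY
    have hpY : p ∉ Y := fun h => (mem_erase.1 (hYg h)).1 rfl
    have hYg0 : Y ⊆ gr M := fun x hx => (mem_erase.1 (hYg hx)).2
    have hpZ : p ∈ gr M \ Y := mem_sdiff.2 ⟨hpg, hpY⟩
    have h1 := rk_contract_add_one hp hYg
    have h2 := rk_contract_add_one hp (sdiff_subset : (gr M).erase p \ Y ⊆ (gr M).erase p)
    rw [erase_sdiff, insert_erase hpZ] at h2
    rw [erase_sdiff] at hYc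
    have hc := card_erase_add_one hpZ
    have hrI : rk M (insert p Y) = k + 1 := by rw [← h1, hYr, hYk]
    have hrY : rk M Y = k := by
      have := rk_insert_le (M := M) p Y
      have := rk_le_card (M := M) Y
      omega
    have hZ : rk M (gr M \ Y) = (gr M \ Y).card := by omega
    rw [mem_filter, mem_biIndepSets, mem_biIndepSets]
    refine ⟨⟨hYg0, hYk, by rw [hrY, hYk], hZ⟩, hpY, insert_subset hpg hYg0,
      by rw [card_insert_of_notMem hpY, hYk], by rw [hrI, card_insert_of_notMem hpY, hYk], ?_⟩
    exact rk_eq_card_of_subset_of_rk_eq_card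
      (sdiff_subset_sdiff (subset_refl _) (subset_insert _ _)) hZ

/-- A bi-independent `k`-set captures at most `k` elements of its complement: `Z ∩ cl X` is an independent subset
of the flat `cl X` of rank `k`. -/
theorem card_captured_le {k : ℕ} {X : Finset α} (hX : X ∈ biIndepSets M k) :
    ((gr M \ X).filter (fun p => p ∈ clF M X)).card ≤ k := by
  rw [mem_biIndepSets] at hX
  obtain ⟨_, hXk, hXr, hXc⟩ := hX
  set C := (gr M \ X).filter (fun p => p ∈ clF M X) with hC
  have hCZ : C ⊆ gr M \ X := filter_subset _ _
  have hZind : M.Indep ((gr M \ X : Finset α) : Set α) := indep_of_rk_eq_card' hXc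
  have hCind : M.Indep (C : Set α) := hZind.subset (by exact_mod_cast hCZ)
  have hCcl : (C : Set α) ⊆ M.closure (X : Set α) := by
    rw [← coe_clF]
    intro p hp
    have hp' : p ∈ C := by exact_mod_cast hp
    rw [hC, mem_filter] at hp'
    exact_mod_cast hp'.2
  have h1 : (C : Set α).encard ≤ M.eRk (M.closure (X : Set α)) := hCind.encard_le_eRk_of_subset hCcl
  rw [M.eRk_closure_eq, ← coe_rk, hXr, hXk, Set.encard_coe_eq_coe_finsetCard] at h1
  exact_mod_cast h1

/-- A bi-independent `k`-set has at least `N − 2k` bi-independent extensions. -/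
theorem card_ext_ge {k : ℕ} {X : Finset α} (hX : X ∈ biIndepSets M k) :
    (gr M).card - 2 * k ≤
      ((gr M).filter (fun p => p ∉ X ∧ insert p X ∈ biIndepSets M (k + 1))).card := by
  have hXg : X ⊆ gr M := (mem_biIndepSets.1 hX).1
  have hXk : X.card = k := (mem_biIndepSets.1 hX).2.1
  have hsplit := card_filter_add_card_filter_not (s := gr M \ X)
    (fun p => insert p X ∈ biIndepSets M (k + 1))
  have hZ : (gr M \ X).card = (gr M).card - k := by rw [card_sdiff_of_subset hXg, hXk]
  have hcap : ((gr M \ X).filter (fun p => ¬ insert p X ∈ biIndepSets M (k + 1))).card ≤ k := by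
    refine le_trans (card_le_card ?_) (card_captured_le hX)
    intro p hp
    rw [mem_filter] at hp ⊢
    obtain ⟨hpZ, hpn⟩ := hp
    refine ⟨hpZ, ?_⟩
    rw [mem_sdiff] at hpZ
    by_contra hcl
    exact hpn ((insert_mem_biIndepSets_iff hX hpZ.1 hpZ.2).2 hcl)
  have heq : (gr M).filter (fun p => p ∉ X ∧ insert p X ∈ biIndepSets M (k + 1)) =
      (gr M \ X).filter (fun p => insert p X ∈ biIndepSets M (k + 1)) := by
    ext p
    simp only [mem_filter, mem_sdiff]
    tauto
  rw [heq]
  omega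

/-- `Σ_p c^p_k` counts the pairs `X ⊂ X'` of bi-independent sets at levels `k`, `k + 1` (double count). -/
theorem sum_extCount_eq (M : Matroid α) [M.Finite] (k : ℕ) :
    ∑ p ∈ gr M, extCount M k p =
      ∑ X ∈ biIndepSets M k,
        ((gr M).filter (fun p => p ∉ X ∧ insert p X ∈ biIndepSets M (k + 1))).card := by
  unfold extCount
  exact Finset.sum_card_bipartiteAbove_eq_sum_card_bipartiteBelow
    (fun (p : α) (X : Finset α) => p ∉ X ∧ insert p X ∈ biIndepSets M (k + 1))

/-- `Σ_p c^p_k ≥ (N − 2k) · P_k`. -/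
theorem sum_extCount_ge (M : Matroid α) [M.Finite] (k : ℕ) :
    ((gr M).card - 2 * k) * (biIndepSets M k).card ≤ ∑ p ∈ gr M, extCount M k p := by
  rw [sum_extCount_eq, mul_comm]
  have h := card_nsmul_le_sum (biIndepSets M k)
    (fun X => ((gr M).filter (fun p => p ∉ X ∧ insert p X ∈ biIndepSets M (k + 1))).card)
    ((gr M).card - 2 * k) (fun X hX => card_ext_ge hX)
  simpa only [smul_eq_mul] using h

/-- **THE AUTOMATIC REGIME OF (Ĉ)**: if `P_k ≤ (k + 1) · c^p_k` then (Ĉ) holds at `(M, p, k)` — from Theorem A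
alone (CONDITIONAL on the named fact). -/
theorem pointedRow_of_le_extCount (hfact : BiIndepDensityLogConcave α) (M : Matroid α) [M.Finite] (p : α)
    (k : ℕ) (hk : 2 * k + 2 ≤ (gr M).card) (hc : (biIndepSets M k).card ≤ (k + 1) * extCount M k p) :
    ((gr M).card - k - 1) * (biIndepSets M k).card ≤
      k * (biIndepSets M (k + 1)).card + ((gr M).card - 2 * k - 1) * extCount M k p := by
  have hA := biIndepDensity_mono_of_fact hfact M k hk
  obtain ⟨m, hm⟩ := Nat.exists_eq_add_of_le hk
  rw [hm] at hA ⊢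
  rw [show 2 * k + 2 + m - k = k + 2 + m by omega] at hA
  rw [show 2 * k + 2 + m - k - 1 = k + 1 + m by omega, show 2 * k + 2 + m - 2 * k - 1 = m + 1 by omega]
  generalize hP : (biIndepSets M k).card = P at hA hc ⊢
  generalize hP' : (biIndepSets M (k + 1)).card = P' at hA ⊢
  generalize hcc : extCount M k p = c at hc ⊢
  apply Nat.le_of_mul_le_mul_left (c := k + 1) _ (by omega)
  have h1 := Nat.mul_le_mul_left k hA
  have h2 := Nat.mul_le_mul_left (m + 1) hc
  have key : (k + 1) * ((k + 1 + m) * P) = k * ((k + 2 + m) * P) + (m + 1) * P := by ring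
  have key' : k * ((k + 1) * P') + (m + 1) * ((k + 1) * c) = (k + 1) * (k * P' + (m + 1) * c) := by ring
  calc (k + 1) * ((k + 1 + m) * P) = k * ((k + 2 + m) * P) + (m + 1) * P := key
    _ ≤ k * ((k + 1) * P') + (m + 1) * ((k + 1) * c) := Nat.add_le_add h1 h2
    _ = (k + 1) * (k * P' + (m + 1) * c) := key'

/-- **THE AVERAGE OF (Ĉ) OVER THE POINT IS A THEOREM** (CONDITIONAL on the named fact):
`N · (N − k − 1) · P_k ≤ N · k · P_{k+1} + (N − 2k − 1) · Σ_{p ∈ E} c^p_k` for `2k + 2 ≤ N`. -/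
theorem pointed_average_of_fact (hfact : BiIndepDensityLogConcave α) (M : Matroid α) [M.Finite] (k : ℕ)
    (hk : 2 * k + 2 ≤ (gr M).card) :
    (gr M).card * ((gr M).card - k - 1) * (biIndepSets M k).card ≤
      (gr M).card * k * (biIndepSets M (k + 1)).card +
        ((gr M).card - 2 * k - 1) * ∑ p ∈ gr M, extCount M k p := by
  have hA := biIndepDensity_mono_of_fact hfact M k hk
  have hE := sum_extCount_ge M k
  obtain ⟨m, hm⟩ := Nat.exists_eq_add_of_le hk
  rw [hm] at hA hE ⊢
  rw [show 2 * k + 2 + m - k = k + 2 + m by omega] at hA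
  rw [show 2 * k + 2 + m - 2 * k = m + 2 by omega] at hE
  rw [show 2 * k + 2 + m - k - 1 = k + 1 + m by omega, show 2 * k + 2 + m - 2 * k - 1 = m + 1 by omega]
  generalize hP : (biIndepSets M k).card = P at hA hE ⊢
  generalize hP' : (biIndepSets M (k + 1)).card = P' at hA ⊢
  generalize hEE : (∑ p ∈ gr M, extCount M k p) = E at hE ⊢
  apply Nat.le_of_mul_le_mul_left (c := k + 1) _ (by omega)
  have h1 := Nat.mul_le_mul_left ((2 * k + 2 + m) * k) hA
  have h2 := Nat.mul_le_mul_left ((k + 1) * (m + 1)) hE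
  have key : (k + 1) * ((2 * k + 2 + m) * (k + 1 + m) * P) + k * (m + 1) * m * P =
      (2 * k + 2 + m) * k * ((k + 2 + m) * P) + (k + 1) * (m + 1) * ((m + 2) * P) := by ring
  have key' : (2 * k + 2 + m) * k * ((k + 1) * P') + (k + 1) * (m + 1) * E =
      (k + 1) * ((2 * k + 2 + m) * k * P' + (m + 1) * E) := by ring
  calc (k + 1) * ((2 * k + 2 + m) * (k + 1 + m) * P)
      ≤ (k + 1) * ((2 * k + 2 + m) * (k + 1 + m) * P) + k * (m + 1) * m * P := Nat.le_add_right _ _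
    _ = (2 * k + 2 + m) * k * ((k + 2 + m) * P) + (k + 1) * (m + 1) * ((m + 2) * P) := key
    _ ≤ (2 * k + 2 + m) * k * ((k + 1) * P') + (k + 1) * (m + 1) * E := Nat.add_le_add h1 h2
    _ = (k + 1) * ((2 * k + 2 + m) * k * P' + (m + 1) * E) := key'

end PercRepro.Cogirth
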